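import Summits.CriticalPhenomena.PercolationContinuityZ3.Theorems.PercNearOneGluingNoHeavyLowerTailSunflowerGadgetModel
import HarnessLib
import HarnessLib.Audit

/-!
# `NoHeavyLowerTail` (crux stmt-CriticalPhenomena-4575), abstract sunflower cubic: THE GADGET MODEL — part 2: the orientation on extended
# slots, COMPATIBILITY, the instance `gadgetModelOf`, and the transports BAD ⟹ Bad, Good ⟹ GOOD

Support file (seat `prim-ineq-prove-1` gen 71; `--supports stmt-CriticalPhenomena-4575`).  No `sorry`, no named facts.  Continues
`…SunflowerGadgetModel` (the abstract model `GadgetModel.Model`, the typed conjecture `GadgetModelLemma`, the hypotheses `HandleHyp`, modes,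
killer sets, petal rows and ONE LABEL PER EXTENDED SLOT `eq_of_petRow`).  Here: `HasWitT`, the orientation `OH`, the cross-witness lemma
`cross_witness` and **COMPATIBILITY `OH_or_OH`** (memo §3 (A1)+(A2): two extended slots with distinct labels, modes not `{b,c}`, are joined
by an arc), the instance **`gadgetModelOf : GadgetModel.Model K (Rv A) (Fin K)`**, and the transports `rowOf_mem_edgeCore_iff'` (core ⟺
A-slot), `isP_of_rowOf_mem_Wof'`, `nonA_gadgetModelOf_eq_J`, `bad_of_badG'`, `goodG_of_good'` — modelled on gen 40's
`…SunflowerBipartiteConditioning`.  The main bridge theorem and the corollaries are in `…SunflowerGadgetModelSafe`.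
Memo: run/shared/lean/prim/prim-ineq-prove-1/FINDING-LAYERED-prove1-g71.md §3.
-/

namespace Summit.CriticalPhenomena.PercolationContinuityZ3.Theorems.SunflowerPartition

namespace Bridge

open Finset MeasureTheory Literature.Probability.LatticeModels Literature.Probability.Percolation GadgetModel

variable {K n : ℕ}

section Handle

variable (Γ : SimpleGraph (Fin n)) (A : Finset (Fin n)) (b c : Fin n) (V : Fin K → Set (Set (Fin n)))
  (SL : Fin n → Finset (Fin K))


/-- Slot `k` of the free assignment `T` holds a killer of the extended slot `e`. -/
def HasWitT (T : Rv A → Finset (Fin K)) (k : Fin K) (e : Ext K) : Prop :=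
  ∃ x : Rv A, k ∈ T x ∧ KillsT Γ A b c SL x e

/-- The orientation on extended slots: `OH e' e` — labels present and distinct, and every petal row of `e` holds a killer of `e'`. -/
def OH (hbA : b ∉ A) (hcA : c ∉ A) (e' e : Ext K) : Prop :=
  ∃ a a', labH Γ A b c V SL hbA hcA e = some a ∧ labH Γ A b c V SL hbA hcA e' = some a' ∧ a ≠ a' ∧
    ∀ T : Rv A → Finset (Fin K), PetRow Γ A b c V SL hbA hcA T e a → HasWitT Γ A b c SL T e.1 e'

variable {Γ A b c V SL}

/-- The core of COMPATIBILITY: petal rows of two extended slots in distinct petals, not a `b`/`c` pair, exhibit a killer of one in the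
other (memo §3 (F4); the cross edge is an `A`–typed edge, or `b`–`N_T(b)`, or `c`–`N_T(c)`; it cannot be `b`–`c`). [this work] -/
theorem cross_witness (H : HandleHyp Γ A b c V) {e e' : Ext K} {T T' : Rv A → Finset (Fin K)} {a a' : Fin K}
    (hT : PetRow Γ A b c V SL H.hbA H.hcA T e a) (hT' : PetRow Γ A b c V SL H.hbA H.hcA T' e' a') (haa : a ≠ a')
    (hbc : ¬ bcPair e.2 e'.2) :
    HasWitT Γ A b c SL T' e'.1 e ∨ HasWitT Γ A b c SL T e.1 e' := by
  obtain ⟨u, v, huv, hu, hnu, hv, hnv⟩ := exists_cross_edge' H haa hT.1 hT'.1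
  by_cases huA : u ∈ A
  · -- u in the A-part of slot e.1; v is a free vertex of row e'.1 killed via τ₀
    have hk : e.1 ∈ SL u := mem_SL_of_mem_rowOf hu huA
    have hvA : v ∉ A := fun hvA => H.indA u huA v hvA huv
    obtain ⟨y, hy, rfl⟩ := exists_free_of_mem_rowOf hv hvA
    left
    refine ⟨y, hy, Or.inl ?_⟩
    rw [mem_τOf]; exact ⟨u, huA, hk, huv⟩
  by_cases hvA : v ∈ A
  · have hl : e'.1 ∈ SL v := mem_SL_of_mem_rowOf hv hvA
    obtain ⟨x, hx, rfl⟩ := exists_free_of_mem_rowOf hu huA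
    right
    refine ⟨x, hx, Or.inl ?_⟩
    rw [mem_τOf]; exact ⟨v, hvA, hl, huv.symm⟩
  obtain ⟨x, hx, rfl⟩ := exists_free_of_mem_rowOf hu huA
  obtain ⟨y, hy, rfl⟩ := exists_free_of_mem_rowOf hv hvA
  have hxn : e'.1 ∉ T' x := fun h => hnu ((mem_rowOf_of_free x).2 h)
  have hyn : e.1 ∉ T y := fun h => hnv ((mem_rowOf_of_free y).2 h)
  rcases special_of_adj H x.2 y.2 huv with hxb | hxc | hyb | hyc
  · -- x = b: the row of e holds b, so e.2 = b; y ∼ b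
    have hxe : x = ⟨b, H.hbA⟩ := Subtype.ext hxb
    have he2 : e.2 = Mode.b := by rw [← hT.2, modeT_eq_b_iff]; rw [hxe] at hx; exact hx
    by_cases hyc' : y.1 = c
    · have hye : y = ⟨c, H.hcA⟩ := Subtype.ext hyc'
      have he2' : e'.2 = Mode.c := by rw [← hT'.2, modeT_eq_c_iff H hT'.1]; rw [hye] at hy; exact hy
      exact absurd (Or.inl ⟨he2, he2'⟩) hbc
    · left
      exact ⟨y, hy, Or.inr (Or.inl ⟨he2, hxb ▸ huv, hyc'⟩)⟩
  · have hxe : x = ⟨c, H.hcA⟩ := Subtype.ext hxc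
    have he2 : e.2 = Mode.c := by rw [← hT.2, modeT_eq_c_iff H hT.1]; rw [hxe] at hx; exact hx
    by_cases hyb' : y.1 = b
    · have hye : y = ⟨b, H.hbA⟩ := Subtype.ext hyb'
      have he2' : e'.2 = Mode.b := by rw [← hT'.2, modeT_eq_b_iff]; rw [hye] at hy; exact hy
      exact absurd (Or.inr ⟨he2, he2'⟩) hbc
    · left
      exact ⟨y, hy, Or.inr (Or.inr ⟨he2, hxc ▸ huv, hyb'⟩)⟩
  · have hye : y = ⟨b, H.hbA⟩ := Subtype.ext hyb
    have he2' : e'.2 = Mode.b := by rw [← hT'.2, modeT_eq_b_iff]; rw [hye] at hy; exact hy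
    by_cases hxc' : x.1 = c
    · have hxe : x = ⟨c, H.hcA⟩ := Subtype.ext hxc'
      have he2 : e.2 = Mode.c := by rw [← hT.2, modeT_eq_c_iff H hT.1]; rw [hxe] at hx; exact hx
      exact absurd (Or.inr ⟨he2, he2'⟩) hbc
    · right
      exact ⟨x, hx, Or.inr (Or.inl ⟨he2', hyb ▸ huv.symm, hxc'⟩)⟩
  · have hye : y = ⟨c, H.hcA⟩ := Subtype.ext hyc
    have he2' : e'.2 = Mode.c := by rw [← hT'.2, modeT_eq_c_iff H hT'.1]; rw [hye] at hy; exact hy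
    by_cases hxb' : x.1 = b
    · have hxe : x = ⟨b, H.hbA⟩ := Subtype.ext hxb'
      have he2 : e.2 = Mode.b := by rw [← hT.2, modeT_eq_b_iff]; rw [hxe] at hx; exact hx
      exact absurd (Or.inl ⟨he2, he2'⟩) hbc
    · right
      exact ⟨x, hx, Or.inr (Or.inr ⟨he2', hyc ▸ huv.symm, hxb'⟩)⟩

/-- COMPATIBILITY (memo §3 (A1)+(A2) in one statement): two extended slots with distinct labels whose modes are not `{b, c}` are
joined by an arc of the orientation. [this work] -/
theorem OH_or_OH (H : HandleHyp Γ A b c V) {e e' : Ext K}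
    (he : labH Γ A b c V SL H.hbA H.hcA e ≠ none) (he' : labH Γ A b c V SL H.hbA H.hcA e' ≠ none)
    (hne : labH Γ A b c V SL H.hbA H.hcA e ≠ labH Γ A b c V SL H.hbA H.hcA e') (hbc : ¬ bcPair e.2 e'.2) :
    OH Γ A b c V SL H.hbA H.hcA e e' ∨ OH Γ A b c V SL H.hbA H.hcA e' e := by
  classical
  obtain ⟨a, ha⟩ := Option.ne_none_iff_exists'.1 he
  obtain ⟨a', ha'⟩ := Option.ne_none_iff_exists'.1 he'
  have haa : a ≠ a' := by intro h; apply hne; rw [ha, ha', h]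
  by_contra hno
  push Not at hno
  obtain ⟨h1, h2⟩ := hno
  -- no arc e → e': some petal row of e' has no killer of e
  have h1' : ∃ T' : Rv A → Finset (Fin K), PetRow Γ A b c V SL H.hbA H.hcA T' e' a' ∧
      ¬ HasWitT Γ A b c SL T' e'.1 e := by
    by_contra h; push Not at h
    exact h1 ⟨a', a, ha', ha, haa.symm, fun T' hT' => h T' hT'⟩
  have h2' : ∃ T : Rv A → Finset (Fin K), PetRow Γ A b c V SL H.hbA H.hcA T e a ∧
      ¬ HasWitT Γ A b c SL T e.1 e' := by
    by_contra h; push Not at h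
    exact h2 ⟨a, a', ha, ha', haa, fun T hT => h T hT⟩
  obtain ⟨T', hT', hno1⟩ := h1'
  obtain ⟨T, hT, hno2⟩ := h2'
  rcases cross_witness H hT hT' haa hbc with h | h
  · exact hno1 h
  · exact hno2 h

variable (Γ A b c V SL)

/-- **The gadget-model instance** of the `A`-part `SL`. [this work] -/
noncomputable def gadgetModelOf (H : HandleHyp Γ A b c V) : GadgetModel.Model K (Rv A) (Fin K) := by
  classical exact
  { vb := ⟨b, H.hbA⟩
    vc := ⟨c, H.hcA⟩
    hbc := fun h => H.hbc.ne (congrArg Subtype.val h)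
    τ₀ := τOf Γ A SL
    Nb := univ.filter fun x : Rv A => Γ.Adj b x.1 ∧ x.1 ≠ c
    Nc := univ.filter fun x : Rv A => Γ.Adj c x.1 ∧ x.1 ≠ b
    τ₀_vb := by
      ext k
      simp only [Finset.notMem_empty, iff_false, mem_τOf]
      rintro ⟨u, huA, -, hub⟩
      exact H.hb u huA hub
    τ₀_vc := by
      ext k
      simp only [Finset.notMem_empty, iff_false, mem_τOf]
      rintro ⟨u, huA, -, huc⟩
      exact H.hc u huA huc
    vb_notMem := by
      constructor
      · simp
      · simp
    vc_notMem := by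
      constructor
      · simp
      · simp
    disj := by
      rw [Finset.disjoint_filter]
      rintro x - ⟨hbx, -⟩ ⟨hcx, -⟩
      exact H.tf {b, c, x.1} (SimpleGraph.is3Clique_triple_iff.2 ⟨H.hbc, hbx, hcx⟩)
    lab := labH Γ A b c V SL H.hbA H.hcA
    O := OH Γ A b c V SL H.hbA H.hcA
    arc := fun e e' _ he he' hne hbc => OH_or_OH H he he' hne hbc }

variable {Γ A b c V SL}

/-- The model's killer relation is `KillsT`. -/
theorem kills_iff (H : HandleHyp Γ A b c V) (x : Rv A) (e : Ext K) :
    (gadgetModelOf Γ A b c V SL H).Kills x e ↔ KillsT Γ A b c SL x e := by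
  classical
  unfold GadgetModel.Model.Kills KillsT gadgetModelOf
  simp only [Finset.mem_filter, Finset.mem_univ, true_and]

/-- The model's witness relation is `HasWitT`. -/
theorem hasWit_iff (H : HandleHyp Γ A b c V) (T : Rv A → Finset (Fin K)) (k : Fin K) (e : Ext K) :
    (gadgetModelOf Γ A b c V SL H).HasWit T k e ↔ HasWitT Γ A b c SL T k e := by
  unfold GadgetModel.Model.HasWit HasWitT
  simp only [kills_iff]

/-- The model's mode is `modeT`. -/
theorem mode_eq (H : HandleHyp Γ A b c V) (T : Rv A → Finset (Fin K)) (k : Fin K) :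
    (gadgetModelOf Γ A b c V SL H).mode T k = modeT A b c H.hbA H.hcA T k := rfl

/-! #### Transport between the global BAD/GOOD and the model's Bad/Good -/

/-- A row lies in the core iff its slot is an A-slot of the model. [this work] -/
theorem rowOf_mem_edgeCore_iff' (H : HandleHyp Γ A b c V) (T : Rv A → Finset (Fin K)) (k : Fin K) :
    rowOf A SL T k ∈ SafeCalc.edgeCore Γ ↔ (gadgetModelOf Γ A b c V SL H).IsA T k := by
  classical
  set M := gadgetModelOf Γ A b c V SL H with hM
  have hDead : M.Dead T k ↔ k ∈ T ⟨b, H.hbA⟩ ∧ k ∈ T ⟨c, H.hcA⟩ := Iff.rfl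
  constructor
  · rintro ⟨u, v, huv, hu, hv⟩
    by_cases huA : u ∈ A
    · have hk : k ∈ SL u := mem_SL_of_mem_rowOf hu huA
      have hvA : v ∉ A := fun hvA => H.indA u huA v hvA huv
      obtain ⟨y, hy, rfl⟩ := exists_free_of_mem_rowOf hv hvA
      refine Or.inr ⟨y, hy, (kills_iff H y _).2 (Or.inl ?_)⟩
      show k ∈ τOf Γ A SL y
      rw [mem_τOf]; exact ⟨u, huA, hk, huv⟩
    by_cases hvA : v ∈ A
    · have hk : k ∈ SL v := mem_SL_of_mem_rowOf hv hvA
      obtain ⟨x, hx, rfl⟩ := exists_free_of_mem_rowOf hu huA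
      refine Or.inr ⟨x, hx, (kills_iff H x _).2 (Or.inl ?_)⟩
      show k ∈ τOf Γ A SL x
      rw [mem_τOf]; exact ⟨v, hvA, hk, huv.symm⟩
    obtain ⟨x, hx, rfl⟩ := exists_free_of_mem_rowOf hu huA
    obtain ⟨y, hy, rfl⟩ := exists_free_of_mem_rowOf hv hvA
    -- one endpoint is b or c
    have key : ∀ x y : Rv A, k ∈ T x → k ∈ T y → Γ.Adj x.1 y.1 → (x.1 = b ∨ x.1 = c) → M.IsA T k := by
      intro x y hx hy hxy hsp
      rcases hsp with hxb | hxc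
      · have hxe : x = ⟨b, H.hbA⟩ := Subtype.ext hxb
        have hkb : k ∈ T ⟨b, H.hbA⟩ := hxe ▸ hx
        by_cases hyc : y.1 = c
        · have hye : y = ⟨c, H.hcA⟩ := Subtype.ext hyc
          have hkc : k ∈ T ⟨c, H.hcA⟩ := hye ▸ hy
          exact Or.inl ⟨hkb, hkc⟩
        · have hmode : M.mode T k = Mode.b := by rw [mode_eq, modeT_eq_b_iff]; exact hkb
          refine Or.inr ⟨y, hy, (kills_iff H y _).2 (Or.inr (Or.inl ⟨?_, hxb ▸ hxy, hyc⟩))⟩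
          show (M.ext T k).2 = Mode.b
          exact hmode
      · have hxe : x = ⟨c, H.hcA⟩ := Subtype.ext hxc
        have hkc : k ∈ T ⟨c, H.hcA⟩ := hxe ▸ hx
        by_cases hyb : y.1 = b
        · have hye : y = ⟨b, H.hbA⟩ := Subtype.ext hyb
          have hkb : k ∈ T ⟨b, H.hbA⟩ := hye ▸ hy
          exact Or.inl ⟨hkb, hkc⟩
        · by_cases hkb : k ∈ T ⟨b, H.hbA⟩
          · exact Or.inl ⟨hkb, hkc⟩
          · have hmode : M.mode T k = Mode.c := by
              rw [mode_eq]; unfold modeT; rw [if_neg hkb, if_pos hkc]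
            refine Or.inr ⟨y, hy, (kills_iff H y _).2 (Or.inr (Or.inr ⟨?_, hxc ▸ hxy, hyb⟩))⟩
            show (M.ext T k).2 = Mode.c
            exact hmode
    rcases special_of_adj H x.2 y.2 huv with hxb | hxc | hyb | hyc
    · exact key x y hx hy huv (Or.inl hxb)
    · exact key x y hx hy huv (Or.inr hxc)
    · exact key y x hy hx huv.symm (Or.inl hyb)
    · exact key y x hy hx huv.symm (Or.inr hyc)
  · rintro (⟨hkb, hkc⟩ | ⟨x, hkx, hkill⟩)
    · exact ⟨b, c, H.hbc, (mem_rowOf_of_free ⟨b, H.hbA⟩).2 hkb, (mem_rowOf_of_free ⟨c, H.hcA⟩).2 hkc⟩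
    · rw [kills_iff] at hkill
      rcases hkill with hk | ⟨hm, hbx, -⟩ | ⟨hm, hcx, -⟩
      · change k ∈ τOf Γ A SL x at hk
        rw [mem_τOf] at hk
        obtain ⟨u, huA, hku, hux⟩ := hk
        exact ⟨u, x.1, hux, Or.inl ⟨huA, hku⟩, (mem_rowOf_of_free x).2 hkx⟩
      · change M.mode T k = Mode.b at hm
        rw [mode_eq, modeT_eq_b_iff] at hm
        exact ⟨b, x.1, hbx, (mem_rowOf_of_free ⟨b, H.hbA⟩).2 hm, (mem_rowOf_of_free x).2 hkx⟩
      · change M.mode T k = Mode.c at hm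
        rw [mode_eq] at hm
        have hkc := mem_of_modeT_eq_c H.hbA H.hcA hm
        exact ⟨c, x.1, hcx, (mem_rowOf_of_free ⟨c, H.hcA⟩).2 hkc, (mem_rowOf_of_free x).2 hkx⟩

/-- A row lying in a petal makes its slot a P-slot of the model. -/
theorem isP_of_rowOf_mem_Wof' (H : HandleHyp Γ A b c V) {T : Rv A → Finset (Fin K)} {k j : Fin K}
    (h : rowOf A SL T k ∈ Wof Γ V j) : (gadgetModelOf Γ A b c V SL H).IsP T k := by
  have hpet : PetRow Γ A b c V SL H.hbA H.hcA T ((gadgetModelOf Γ A b c V SL H).ext T k) j := ⟨h, rfl⟩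
  refine ⟨fun hA => h.2 ((rowOf_mem_edgeCore_iff' H T k).2 hA), ?_, ?_⟩
  · show labH Γ A b c V SL H.hbA H.hcA _ ≠ none
    rw [labH_eq_some H hpet]; exact Option.some_ne_none _
  · rintro e' ⟨a, a', hka, -, -, hwit⟩
    change labH Γ A b c V SL H.hbA H.hcA _ = some a at hka
    rw [labH_eq_some H hpet] at hka
    obtain rfl : j = a := Option.some_injective _ hka
    exact (hasWit_iff H T k e').2 (hwit T hpet)

/-- The model's non-A set is the set of independent rows of the glued configuration. -/
theorem nonA_gadgetModelOf_eq_J (H : HandleHyp Γ A b c V) (T : Rv A → Finset (Fin K)) :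
    (gadgetModelOf Γ A b c V SL H).nonA T = J (SafeCalc.edgeCore Γ) (glue A SL T) := by
  ext k
  rw [GadgetModel.Model.mem_nonA_iff, mem_J, row_glue, rowOf_mem_edgeCore_iff' H T k]
  exact Iff.rfl

/-- Global BAD ⟹ model Bad. -/
theorem bad_of_badG' (H : HandleHyp Γ A b c V) {T : Rv A → Finset (Fin K)}
    (hb : BadG (SafeCalc.edgeCore Γ) (Wof Γ V) (glue A SL T)) : (gadgetModelOf Γ A b c V SL H).Bad T := by
  obtain ⟨h2, f, hfinj, hf⟩ := hb
  rw [← nonA_gadgetModelOf_eq_J H T] at h2 hfinj hf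
  refine ⟨h2, fun k hk => ?_, fun k hk l hl hkl => ?_⟩
  · have := hf k hk; rw [row_glue] at this
    exact isP_of_rowOf_mem_Wof' H this
  · have hk' := hf k hk; have hl' := hf l hl
    rw [row_glue] at hk' hl'
    have hpk : PetRow Γ A b c V SL H.hbA H.hcA T ((gadgetModelOf Γ A b c V SL H).ext T k) (f k) := ⟨hk', rfl⟩
    have hpl : PetRow Γ A b c V SL H.hbA H.hcA T ((gadgetModelOf Γ A b c V SL H).ext T l) (f l) := ⟨hl', rfl⟩
    show labH Γ A b c V SL H.hbA H.hcA _ ≠ labH Γ A b c V SL H.hbA H.hcA _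
    rw [labH_eq_some H hpk, labH_eq_some H hpl]
    intro h
    exact hkl (hfinj hk hl (Option.some_injective _ h))

/-- Model Good ⟹ global GOOD. -/
theorem goodG_of_good' (H : HandleHyp Γ A b c V) {T : Rv A → Finset (Fin K)} (hg : (gadgetModelOf Γ A b c V SL H).Good T) :
    GoodG (SafeCalc.edgeCore Γ) (Wof Γ V) (glue A SL T) := by
  obtain ⟨z, hz, hnp⟩ := hg
  refine ⟨z, ?_, fun j hj => hnp ?_⟩
  · rw [← nonA_gadgetModelOf_eq_J H T, hz]
  · rw [row_glue] at hj
    exact isP_of_rowOf_mem_Wof' H hj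

end Handle

end Bridge

end Summit.CriticalPhenomena.PercolationContinuityZ3.Theorems.SunflowerPartition
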